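import Literature.MathematicalPhysics.QuantumFieldTheory.Balaban1983to89.T4TriangularPushforward

/-!
# Route `ReplicaVarianceTilt` — crux `HeightChiSqL` (stmt-QuantumFields-26133), toward the residual of `stub_acIntegrable`:
# BOUNDED TRIANGULAR PUSH-FORWARD — product measures under maps with private coordinates: DOMINATED one-variable laws give a
# DOMINATED image law (the quantitative form of the tree's `T4TriangularPushforward`; helper `--supports stmt-QuantumFields-26133`)

Width seat `ym-line-sfw-p2-w3` gen 21 (home cell `ym-idea-1`; R3 RECORD rung — no summit, no rung and no crux is proved here; the YM mass
gap is NOT proved by any of this).  Pure measure theory over Mathlib and the tree module `T4TriangularPushforward` (whose `IsLocal`, resampling map and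
`measurePreserving_resample` are reused by name); no Bałaban content, every declaration is [folklore].  PURPOSE ONLY: the
qualitative module proved that Bałaban's block averaging `U ↦ Ū` ([Balaban1987RG1] (0.4) p. 253) pushes product Haar measure to an
ABSOLUTELY CONTINUOUS measure (`HaarAC`) from the absolute continuity of the one-variable laws in the private coordinates.  The
chi-square currency of the R3 route `ReplicaVarianceTilt` (crux `HeightChiSqL`, stmt-QuantumFields-26133; tree
`Summit….Theorems.HeightChiSqLOneStepWindow.stubText_iff_oneStepWeightSqOnWindow`) needs MORE than absolute continuity: square-
integrability of the one-step renormalised weight, which follows from a BOUNDED image density.  This module is the measure-theoretic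
half of that upgrade: if the one-variable laws are DOMINATED, `μ.map (g ↦ A (update U (β c) g) c) ≤ C c • μ` for a.e. environment
`U` and every output coordinate `c`, then `(μ^ι).map A ≤ (∏_c C c) • μ^κ` (`map_pi_le_smul_pi`).  The geometric half — a uniform
bound `C` for the guarded exp-mean-log fibre laws on `SU(2)` (quantitative `T4EMLFibreAC`) — is NOT here.

CONTENT.
* §1 `pi_le_smul_pi`: finite products of dominated σ-finite measures are dominated, `(∀ i, ν i ≤ C i • μ i) → Measure.pi ν ≤
  (∏ i, C i) • Measure.pi μ` (`Fin n` induction along `MeasurableEquiv.piFinSuccAbove` with `Measure.prod_mono`,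
  `Measure.prod_smul_left/right`, then transport along `MeasurableEquiv.piCongrLeft`).
* §2 `map_prod_pi_le_smul_pi` (the mixture engine): for a probability law `ν` of an environment `e`, a finite measure `μ` and jointly
  measurable one-variable maps `f c e : G → G` with `μ.map (f c e) ≤ C c • μ` for `ν`-a.e. `e`, the map `(e, g) ↦ (c ↦ f c e (g c))` pushes
  `ν ⊗ μ^κ` to a measure `≤ (∏ C) • μ^κ` (`Measure.prod_apply`, `Measure.pi_map_pi`, §1).
* §3 `map_pi_le_smul_pi`: under `IsLocal β A`, `β` injective, `A` measurable and dominated one-variable laws for `μ^ι`-a.e. configuration,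
  `(μ^ι).map A ≤ (∏_c C c) • μ^κ` (resampling: `T4TriangularPushforward.measurePreserving_resample` + `apply_resample_eq` + §2);
  `map_pi_le_smul_pi_of_forall` (everywhere hypothesis).
VALUE = kernel measure theory (an engine for the `L²`/`L^∞` upgrade of `HaarAC`); NOT an estimate of the papers, NOT summit progress.
-/

noncomputable section

open MeasureTheory Set Function
open scoped ENNReal

namespace Summit.QuantumFields.YangMills.Theorems.HeightChiSqLTriangularBounded

open Literature.MathematicalPhysics.QuantumFieldTheory.Balaban1983to89.T4TriangularPushforward

/-! ## 1. Finite products of dominated measures are dominated -/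

section Products

variable {γ : Type*} [MeasurableSpace γ]

/-- Finite products of dominated σ-finite measures are dominated, `Fin n`-indexed case:
`(∀ i, ν i ≤ C i • μ i) → Measure.pi ν ≤ (∏ i, C i) • Measure.pi μ`. [folklore] -/
theorem pi_le_smul_pi_fin {n : ℕ} {μ ν : Fin n → Measure γ} [∀ i, SigmaFinite (μ i)] [∀ i, SigmaFinite (ν i)]
    (C : Fin n → ℝ≥0∞) (h : ∀ i, ν i ≤ C i • μ i) : Measure.pi ν ≤ (∏ i, C i) • Measure.pi μ := by
  induction n with
  | zero =>
      rw [Measure.pi_of_empty μ, Measure.pi_of_empty ν]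
      simp
  | succ n ih =>
      have hμ := measurePreserving_piFinSuccAbove μ 0
      have hν := measurePreserving_piFinSuccAbove ν 0
      have ih' : Measure.pi (fun j => ν (Fin.succAbove 0 j)) ≤
          (∏ j, C (Fin.succAbove 0 j)) • Measure.pi (fun j => μ (Fin.succAbove 0 j)) :=
        ih (fun j => C (Fin.succAbove 0 j)) (fun j => h _)
      have hprod : (ν 0).prod (Measure.pi fun j => ν (Fin.succAbove 0 j)) ≤
          (C 0 * ∏ j, C (Fin.succAbove 0 j)) • (μ 0).prod (Measure.pi fun j => μ (Fin.succAbove 0 j)) := by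
        calc (ν 0).prod (Measure.pi fun j => ν (Fin.succAbove 0 j))
            ≤ (C 0 • μ 0).prod ((∏ j, C (Fin.succAbove 0 j)) • Measure.pi fun j => μ (Fin.succAbove 0 j)) :=
              Measure.prod_mono (h 0) ih'
          _ = (C 0 * ∏ j, C (Fin.succAbove 0 j)) • (μ 0).prod (Measure.pi fun j => μ (Fin.succAbove 0 j)) := by
              rw [Measure.prod_smul_left, Measure.prod_smul_right, smul_smul]
      have := Measure.map_mono hprod (MeasurableEquiv.piFinSuccAbove (fun _ : Fin (n + 1) => γ) 0).symm.measurable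
      rw [Measure.map_smul, (hν.symm _).map_eq, (hμ.symm _).map_eq, ← Fin.prod_univ_succAbove C 0] at this
      exact this

/-- Finite products of dominated σ-finite measures are dominated: `(∀ i, ν i ≤ C i • μ i) → Measure.pi ν ≤ (∏ i, C i) • Measure.pi μ`
(transport of the `Fin n` case along `MeasurableEquiv.piCongrLeft`). [folklore] -/
theorem pi_le_smul_pi {ι : Type*} [Fintype ι] {μ ν : ι → Measure γ} [∀ i, SigmaFinite (μ i)]
    [∀ i, SigmaFinite (ν i)] (C : ι → ℝ≥0∞) (h : ∀ i, ν i ≤ C i • μ i) :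
    Measure.pi ν ≤ (∏ i, C i) • Measure.pi μ := by
  set e := (Fintype.equivFin ι).symm with he
  have hμ := measurePreserving_piCongrLeft μ e
  have hν := measurePreserving_piCongrLeft ν e
  have hfin : Measure.pi (fun i' => ν (e i')) ≤ (∏ i', C (e i')) • Measure.pi (fun i' => μ (e i')) :=
    pi_le_smul_pi_fin (fun i' => C (e i')) (fun i' => h _)
  have := Measure.map_mono hfin (MeasurableEquiv.piCongrLeft (fun _ : ι => γ) e).measurable
  rw [Measure.map_smul, hν.map_eq, hμ.map_eq, Equiv.prod_comp e C] at this
  exact this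

end Products

/-! ## 2. The mixture engine with dominated one-variable laws -/

section Resampling

variable {E ι κ G : Type*} [MeasurableSpace E] [MeasurableSpace G]

/-- THE MIXTURE ENGINE, DOMINATED FORM.  Let `ν` be a probability law of an "environment" `e : E`, `μ` a finite measure on `G`, and
`f c : E → G → G` (`c : κ`) jointly measurable one-variable maps such that for `ν`-a.e. `e` and every `c` the law of `f c e` under `μ`
is `≤ C c • μ`.  Then `(e, g) ↦ (c ↦ f c e (g c))` pushes `ν ⊗ μ^κ` to a measure `≤ (∏ C) • μ^κ`: conditionally on `e` the output is
a product of independent dominated coordinates (`Measure.pi_map_pi`, `pi_le_smul_pi`), and a probability mixture of dominated measures is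
dominated (`Measure.prod_apply`). [folklore] -/
theorem map_prod_pi_le_smul_pi [Fintype κ] (ν : Measure E) [IsProbabilityMeasure ν] (μ : Measure G) [IsFiniteMeasure μ]
    (f : κ → E → G → G) (hf : ∀ c, Measurable (uncurry (f c))) (C : κ → ℝ≥0∞)
    (hbd : ∀ᵐ e ∂ν, ∀ c, μ.map (f c e) ≤ C c • μ) :
    (ν.prod (Measure.pi fun _ : κ => μ)).map (fun p : E × (κ → G) => fun c => f c p.1 (p.2 c)) ≤
      (∏ c, C c) • Measure.pi fun _ : κ => μ := by
  have hΦ : Measurable (fun p : E × (κ → G) => fun c => f c p.1 (p.2 c)) :=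
    measurable_pi_lambda _ fun c =>
      (hf c).comp (measurable_fst.prodMk ((measurable_pi_apply c).comp measurable_snd))
  refine Measure.le_iff.2 fun s hs => ?_
  rw [Measure.map_apply hΦ hs, Measure.prod_apply (hΦ hs), Measure.smul_apply, smul_eq_mul]
  calc ∫⁻ e, (Measure.pi fun _ : κ => μ)
          (Prod.mk e ⁻¹' ((fun p : E × (κ → G) => fun c => f c p.1 (p.2 c)) ⁻¹' s)) ∂ν
      ≤ ∫⁻ _, (∏ c, C c) * (Measure.pi fun _ : κ => μ) s ∂ν := by
        refine lintegral_mono_ae (hbd.mono fun e he => ?_)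
        have hfe : ∀ c, Measurable (f c e) := fun c => (hf c).comp (measurable_const.prodMk measurable_id)
        have hΦe : Measurable (fun g : κ → G => fun c => f c e (g c)) :=
          measurable_pi_lambda _ fun c => (hfe c).comp (measurable_pi_apply c)
        have h1 : Prod.mk e ⁻¹' ((fun p : E × (κ → G) => fun c => f c p.1 (p.2 c)) ⁻¹' s) =
            (fun g : κ → G => fun c => f c e (g c)) ⁻¹' s := rfl
        rw [h1, ← Measure.map_apply hΦe hs, Measure.pi_map_pi (fun c => (hfe c).aemeasurable)]
        have hle := pi_le_smul_pi (μ := fun _ : κ => μ) (ν := fun c => μ.map (f c e)) C he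
        have := Measure.le_iff'.1 hle s
        rwa [Measure.smul_apply, smul_eq_mul] at this
    _ = (∏ c, C c) * (Measure.pi fun _ : κ => μ) s := by rw [lintegral_const, measure_univ, mul_one]

/-! ## 3. The image law under dominated one-variable laws -/

/-- **THEOREM (bounded triangular push-forward).**  Let `μ` be a probability measure, `β` an injection of private coordinates for the
measurable map `A` with `IsLocal β A`, and suppose that for `μ^ι`-a.e. configuration `U` the one-variable laws are dominated,
`μ.map (g ↦ A (update U (β c) g) c) ≤ C c • μ` for all `c`.  Then `(μ^ι).map A ≤ (∏_c C c) • μ^κ` — in particular the image law has a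
density bounded by `∏_c C c`.  Proof: resampling (`T4TriangularPushforward.measurePreserving_resample`, `apply_resample_eq`) and §2. [folklore] -/
theorem map_pi_le_smul_pi [Fintype ι] [Fintype κ] [DecidableEq ι] (μ : Measure G) [IsProbabilityMeasure μ]
    {β : κ → ι} {A : (ι → G) → (κ → G)} (hA : IsLocal β A) (hβ : Injective β) (hAm : Measurable A) (C : κ → ℝ≥0∞)
    (hbd : ∀ᵐ U ∂(Measure.pi fun _ : ι => μ), ∀ c : κ, μ.map (fun g => A (update U (β c) g) c) ≤ C c • μ) :
    (Measure.pi fun _ : ι => μ).map A ≤ (∏ c, C c) • Measure.pi fun _ : κ => μ := by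
  have hf : ∀ c : κ, Measurable (uncurry fun (U : ι → G) (g : G) => A (update U (β c) g) c) := fun c =>
    (measurable_pi_apply c).comp (hAm.comp measurable_update')
  have hres := measurePreserving_resample μ hβ
  have key : (fun p : (ι → G) × (κ → G) => fun c => A (update p.1 (β c) (p.2 c)) c) =
      A ∘ (fun p : (ι → G) × (κ → G) => extend β p.2 p.1) := by
    funext p
    funext c
    exact (apply_resample_eq hA hβ p.1 p.2 c).symm
  have h := map_prod_pi_le_smul_pi (Measure.pi fun _ : ι => μ) μ
    (fun c (U : ι → G) (g : G) => A (update U (β c) g) c) hf C hbd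
  rw [key, ← Measure.map_map hAm hres.measurable, hres.map_eq] at h
  exact h

/-- The everywhere form: dominated one-variable laws for EVERY configuration give `(μ^ι).map A ≤ (∏_c C c) • μ^κ`. [folklore] -/
theorem map_pi_le_smul_pi_of_forall [Fintype ι] [Fintype κ] [DecidableEq ι] (μ : Measure G) [IsProbabilityMeasure μ]
    {β : κ → ι} {A : (ι → G) → (κ → G)} (hA : IsLocal β A) (hβ : Injective β) (hAm : Measurable A) (C : κ → ℝ≥0∞)
    (hbd : ∀ (U : ι → G) (c : κ), μ.map (fun g => A (update U (β c) g) c) ≤ C c • μ) :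
    (Measure.pi fun _ : ι => μ).map A ≤ (∏ c, C c) • Measure.pi fun _ : κ => μ :=
  map_pi_le_smul_pi μ hA hβ hAm C (ae_of_all _ fun U c => hbd U c)

/-- Reading as a density bound: under the hypotheses of `map_pi_le_smul_pi` the image law is absolutely continuous with Radon–Nikodym
derivative `≤ ∏_c C c` almost everywhere. [folklore] -/
theorem rnDeriv_map_pi_le [Fintype ι] [Fintype κ] [DecidableEq ι] (μ : Measure G) [IsProbabilityMeasure μ]
    {β : κ → ι} {A : (ι → G) → (κ → G)} (hA : IsLocal β A) (hβ : Injective β) (hAm : Measurable A) (C : κ → ℝ≥0∞)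
    (hbd : ∀ᵐ U ∂(Measure.pi fun _ : ι => μ), ∀ c : κ, μ.map (fun g => A (update U (β c) g) c) ≤ C c • μ) :
    ((Measure.pi fun _ : ι => μ).map A).rnDeriv (Measure.pi fun _ : κ => μ) ≤ᵐ[Measure.pi fun _ : κ => μ]
      fun _ => ∏ c, C c := by
  have hle := map_pi_le_smul_pi μ hA hβ hAm C hbd
  refine ae_le_of_forall_setLIntegral_le_of_sigmaFinite (Measure.measurable_rnDeriv _ _) fun s _ _ => ?_
  calc ∫⁻ x in s, ((Measure.pi fun _ : ι => μ).map A).rnDeriv (Measure.pi fun _ : κ => μ) x ∂(Measure.pi fun _ : κ => μ)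
      ≤ ((Measure.pi fun _ : ι => μ).map A) s := Measure.setLIntegral_rnDeriv_le s
    _ ≤ ((∏ c, C c) • Measure.pi fun _ : κ => μ) s := Measure.le_iff'.1 hle s
    _ = ∫⁻ _ in s, (∏ c, C c) ∂(Measure.pi fun _ : κ => μ) := by
        rw [Measure.smul_apply, smul_eq_mul, setLIntegral_const]

end Resampling

end Summit.QuantumFields.YangMills.Theorems.HeightChiSqLTriangularBounded

end
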